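import Mathlib
import HarnessLib
import Summits.Ventures.LatticeQCDFlow.Exactness.GaugeFTHMCSymmetricWord
import Summits.Ventures.LatticeQCDFlow.Exactness.Phi4HMCFluctuationRelation
import Summits.Ventures.LatticeQCDFlow.Exactness.SUNLeapfrogHMC
import Summits.Ventures.LatticeQCDFlow.Exactness.SU2LeapfrogHMC
import Summits.Ventures.LatticeQCDFlow.Exactness.U1LeapfrogHMC

/-!
# The engine's OMF2 proposal on both rungs: reversibility test, Liouville, and Creutz's identity — for every pair of forces

HONEST FRAMING: exact (Metropolis-corrected) sampling algorithms for lattice gauge theory;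
figures of merit are autocorrelation/cost numbers at stated couplings and volumes; no
continuum-physics claim.

Venture `LatticeQCDFlow` (cell pub-lqcd), topic `Exactness`; FANOUT row 14 (`eng-flowhmc`: the engine
`latflow-fthmc`, integrators `leapfrog` and `omf2`; accepted on `⟨e^{−ΔH}⟩ = 1 within 2σ` and a
reversibility test).  NEW WORK of the cell over the tree; nothing is cited as a fact.  Printed
counterparts, named only: Omelyan–Mryglod–Folk 2003 (the OMF2 / 2MN word), Creutz 1988.

`LeapfrogReversibilityTest.lean` typed the row's reversibility test and `GaugeFTHMCCreutz.lean` /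
`Phi4HMCFluctuationRelation.lean` its `⟨e^{−ΔH}⟩ = 1` gate for the LEAPFROG word; the engine's second
integrator is the five-stage OMF2 word `K(g₁) D K(g₂) D K(g₁)` (`omf2Word` of `SplittingWords.lean`; in the
code `g₁ = −λε∇S̃`, `g₂ = −(1−2λ)ε∇S̃`, `D` = the group drift by `ε/2`).  This file records, def-free and for
EVERY pair of force fields `g₁, g₂` (so in particular for the forces the code evaluates, exact or not), the
three structural facts about the OMF2 proposal `Ψ = flip ∘ (omf2Word g₁ D g₂)ⁿ` from which every
equilibrium statement of the battery follows, on both rungs of the engine: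

* §0 (`SU(N)`, the engine's general rung of `SUNLeapfrogHMC.lean`: coordinates `E` of `su(N)` through
  `ι`, momenta `L → E` with any additive Haar measure `μ^{⊗L}`, drift `D = mulDrift (sunExpDrift ι hι δ)`):
  `involutive_sunOmf2ProposalN`, `measurable_sunOmf2ProposalN`, **`measurePreserving_sunOmf2ProposalN`**
  (`Haar^{⊗L} ⊗ μ^{⊗L}` preserved), **`sunOmf2ProposalN_creutz`** (for EVERY `H`).
* §1 (`SU(2)`, Pauli momenta `ι → ℝ³`, drift `D = mulDrift (su2ExpDrift δ)`):
  `involutive_su2Omf2ProposalN` (time reversal: `Ψ ∘ Ψ = id`), hence the REVERSIBILITY TEST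
  `su2Omf2_forward_flip_backward` (forward n steps, flip, backward n steps, flip is the identity on phase
  space) and `su2Omf2ProposalN_roundTrip_energy` (the round-trip change of ANY phase-space function is
  exactly `0`, so it passes every tolerance, `su2Omf2ProposalN_roundTrip_abs_le`);
  `measurable_su2Omf2ProposalN`; **`measurePreserving_su2Omf2ProposalN`** (Liouville: `Ψ` preserves
  `Haar^{⊗ι} ⊗ Lebesgue`, measurable `g₁, g₂`); **`su2Omf2ProposalN_creutz`** — for EVERY Hamiltonian
  `H` on phase space, `∫ e^{−ΔH} e^{−H} = ∫ e^{−H}` over `Haar^{⊗ι} ⊗ Lebesgue` (`ΔH = H∘Ψ − H`), and the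
  whole fluctuation relation `su2Omf2ProposalN_fluctuation_relation` (`∫ g(ΔH)e^{−H} = ∫ g(−ΔH)e^{−ΔH}e^{−H}`
  for every `g`).
* §2 the same list on the `U(1)` rung (`D = mulDrift (u1ExpDrift δ)`, real momenta).

Consequently the abstract laws of `EnergyViolationSecondOrder.lean` (`⟨ΔH⟩ = ½⟨ΔH²⟩` + third order),
`CreutzEstimatorVariance.lean` (`Var e^{−ΔH} = ⟨e^{ΔH}⟩ − 1`), `AcceptanceFromMeanEnergyViolation.lean` and
`InvolutiveMetropolisEnergyBound.lean` apply to the OMF2 proposal verbatim (their hypotheses are exactly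
the three facts above).  NOT CLAIMED: the OMF2 energy-error law (typed separately in
`SU2Omf2EnergyError.lean` / `SU2Omf2TrajectoryEnergyError.lean`), ergodicity of the OMF2 kernel, anything
at fixed floating-point precision (the measured round-trip `|δH| ≈ 10⁻⁹` bounds roundoff, not this `0`).
-/

noncomputable section

namespace Summit.Ventures.LatticeQCDFlow.Exactness

open Set Function MeasureTheory Filter
open Literature.MathematicalPhysics.QuantumFieldTheory
open scoped Matrix

set_option backward.isDefEq.respectTransparency false

/-! ## §0 The `SU(N)` rung (general coordinates) -/

section SUN

variable {N : Type*} [Fintype N] [DecidableEq N] {E : Type*} [NormedAddCommGroup E] [NormedSpace ℝ E]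
  (ι : E →ₗ[ℝ] Matrix N N ℂ) (hι : ∀ a, (ι a)ᴴ = -ι a ∧ (ι a).trace = 0) {L : Type*}
  (g₁ g₂ : (L → Matrix.specialUnitaryGroup N ℂ) → L → E) (δ : ℝ) (n : ℕ)

/-- **Time reversal (OMF2, `SU(N)`)**: `flip ∘ (omf2Word g₁ (mulDrift (sunExpDrift ι hι δ)) g₂)ⁿ` is an
involution, for every pair of force fields. -/
theorem involutive_sunOmf2ProposalN :
    Function.Involutive (⇑((flip : Equiv.Perm ((L → Matrix.specialUnitaryGroup N ℂ) × (L → E))) *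
      omf2Word g₁ (mulDrift (sunExpDrift ι hι δ)) g₂ ^ n)) :=
  (palindromicWord_pow_isFlipReversible flip_mul_flip (kick_isFlipReversible g₂)
    (omf2_stages_isFlipReversible (mulDrift_reversal (sunExpDrift_neg ι hι δ))) n).involutive

variable {g₁ g₂} [MeasurableSpace E] [BorelSpace E] [FiniteDimensional ℝ E]

/-- The `SU(N)` OMF2 proposal is measurable (measurable forces). -/
theorem measurable_sunOmf2ProposalN [Countable L] (hg₁ : Measurable g₁) (hg₂ : Measurable g₂) :
    Measurable (⇑((flip : Equiv.Perm ((L → Matrix.specialUnitaryGroup N ℂ) × (L → E))) *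
      omf2Word g₁ (mulDrift (sunExpDrift ι hι δ)) g₂ ^ n)) :=
  measurable_flip_omf2Word_pow (measurable_sunExpDrift ι hι δ) hg₁ hg₂ n

variable [Fintype L] (μ : Measure E) [μ.IsAddHaarMeasure]

/-- **Liouville (OMF2, `SU(N)`)**: the proposal preserves `Haar^{⊗L} ⊗ μ^{⊗L}` for any additive Haar measure
`μ` on the coordinates and every pair of measurable forces. -/
theorem measurePreserving_sunOmf2ProposalN (hg₁ : Measurable g₁) (hg₂ : Measurable g₂) :
    MeasurePreserving (⇑((flip : Equiv.Perm ((L → Matrix.specialUnitaryGroup N ℂ) × (L → E))) *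
      omf2Word g₁ (mulDrift (sunExpDrift ι hι δ)) g₂ ^ n))
      ((Measure.pi fun _ : L => haarProbability (Matrix.specialUnitaryGroup N ℂ)).prod (Measure.pi fun _ : L => μ))
      ((Measure.pi fun _ : L => haarProbability (Matrix.specialUnitaryGroup N ℂ)).prod (Measure.pi fun _ : L => μ)) := by
  haveI := isNegInvariant_pi (L := L) μ
  rw [Equiv.Perm.coe_mul]
  exact measurePreserving_flip.comp (measurePreserving_perm_pow
    (measurePreserving_palindromicWord (measurePreserving_kick hg₂)
      (omf2_stages_measurePreserving (measurable_mulDrift (measurable_sunExpDrift ι hι δ))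
        (measurePreserving_mulDrift (sunExpDrift ι hι δ)) hg₁)) n)

/-- **CREUTZ'S IDENTITY FOR THE OMF2 PROPOSAL (`SU(N)`)**: for every Hamiltonian `H` on phase space and every
pair of measurable forces, `∫ e^{−ΔH} e^{−H} = ∫ e^{−H}` over `Haar^{⊗L} ⊗ μ^{⊗L}`. -/
theorem sunOmf2ProposalN_creutz (hg₁ : Measurable g₁) (hg₂ : Measurable g₂)
    (H : (L → Matrix.specialUnitaryGroup N ℂ) × (L → E) → ℝ) :
    ∫ z, Real.exp (-deltaH H (⇑((flip : Equiv.Perm ((L → Matrix.specialUnitaryGroup N ℂ) × (L → E))) *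
        omf2Word g₁ (mulDrift (sunExpDrift ι hι δ)) g₂ ^ n)) z) * Real.exp (-H z)
      ∂((Measure.pi fun _ : L => haarProbability (Matrix.specialUnitaryGroup N ℂ)).prod (Measure.pi fun _ : L => μ))
    = ∫ z, Real.exp (-H z)
      ∂((Measure.pi fun _ : L => haarProbability (Matrix.specialUnitaryGroup N ℂ)).prod (Measure.pi fun _ : L => μ)) :=
  creutz_integral (measurable_sunOmf2ProposalN ι hι δ n hg₁ hg₂) (involutive_sunOmf2ProposalN ι hι g₁ g₂ δ n)
    (measurePreserving_sunOmf2ProposalN ι hι δ n μ hg₁ hg₂)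

end SUN

/-! ## §1 The `SU(2)` rung -/

section SU2

variable {ι : Type*} (g₁ g₂ : (ι → Matrix.specialUnitaryGroup (Fin 2) ℂ) → ι → EuclideanSpace ℝ (Fin 3))
  (δ : ℝ) (n : ℕ)

/-- **Time reversal**: the OMF2 proposal `flip ∘ (K(g₁) D K(g₂) D K(g₁))ⁿ` with the Pauli exponential
drift is an involution, for every pair of force fields. -/
theorem involutive_su2Omf2ProposalN :
    Function.Involutive (⇑((flip : Equiv.Perm ((ι → Matrix.specialUnitaryGroup (Fin 2) ℂ) ×
      (ι → EuclideanSpace ℝ (Fin 3)))) * omf2Word g₁ (mulDrift (su2ExpDrift δ)) g₂ ^ n)) :=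
  (palindromicWord_pow_isFlipReversible flip_mul_flip (kick_isFlipReversible g₂)
    (omf2_stages_isFlipReversible (mulDrift_reversal (su2ExpDrift_neg δ))) n).involutive

/-- **THE REVERSIBILITY TEST (OMF2, `SU(2)`)**: forward `n` steps, flip, backward `n` steps, flip is the
identity of phase space — for every pair of forces, every `δ`, every `n`. -/
theorem su2Omf2_forward_flip_backward
    (z : (ι → Matrix.specialUnitaryGroup (Fin 2) ℂ) × (ι → EuclideanSpace ℝ (Fin 3))) :
    ((flip : Equiv.Perm ((ι → Matrix.specialUnitaryGroup (Fin 2) ℂ) × (ι → EuclideanSpace ℝ (Fin 3)))) *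
        omf2Word g₁ (mulDrift (su2ExpDrift δ)) g₂ ^ n)
      (((flip : Equiv.Perm ((ι → Matrix.specialUnitaryGroup (Fin 2) ℂ) × (ι → EuclideanSpace ℝ (Fin 3)))) *
        omf2Word g₁ (mulDrift (su2ExpDrift δ)) g₂ ^ n) z) = z :=
  involutive_su2Omf2ProposalN g₁ g₂ δ n z

/-- The round-trip change of ANY phase-space function `Hf` (the energy `S + T`, an FT energy `S̃ + T`, …) is
exactly `0`. -/
theorem su2Omf2ProposalN_roundTrip_energy
    (Hf : (ι → Matrix.specialUnitaryGroup (Fin 2) ℂ) × (ι → EuclideanSpace ℝ (Fin 3)) → ℝ)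
    (z : (ι → Matrix.specialUnitaryGroup (Fin 2) ℂ) × (ι → EuclideanSpace ℝ (Fin 3))) :
    Hf (((flip : Equiv.Perm ((ι → Matrix.specialUnitaryGroup (Fin 2) ℂ) × (ι → EuclideanSpace ℝ (Fin 3)))) *
          omf2Word g₁ (mulDrift (su2ExpDrift δ)) g₂ ^ n)
        (((flip : Equiv.Perm ((ι → Matrix.specialUnitaryGroup (Fin 2) ℂ) × (ι → EuclideanSpace ℝ (Fin 3)))) *
          omf2Word g₁ (mulDrift (su2ExpDrift δ)) g₂ ^ n) z)) - Hf z = 0 := by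
  rw [su2Omf2_forward_flip_backward, sub_self]

/-- … hence it passes the reversibility test at every tolerance `tol ≥ 0` (in exact arithmetic). -/
theorem su2Omf2ProposalN_roundTrip_abs_le
    (Hf : (ι → Matrix.specialUnitaryGroup (Fin 2) ℂ) × (ι → EuclideanSpace ℝ (Fin 3)) → ℝ) {tol : ℝ}
    (htol : 0 ≤ tol) (z : (ι → Matrix.specialUnitaryGroup (Fin 2) ℂ) × (ι → EuclideanSpace ℝ (Fin 3))) :
    |Hf (((flip : Equiv.Perm ((ι → Matrix.specialUnitaryGroup (Fin 2) ℂ) × (ι → EuclideanSpace ℝ (Fin 3)))) *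
          omf2Word g₁ (mulDrift (su2ExpDrift δ)) g₂ ^ n)
        (((flip : Equiv.Perm ((ι → Matrix.specialUnitaryGroup (Fin 2) ℂ) × (ι → EuclideanSpace ℝ (Fin 3)))) *
          omf2Word g₁ (mulDrift (su2ExpDrift δ)) g₂ ^ n) z)) - Hf z| ≤ tol := by
  rw [su2Omf2ProposalN_roundTrip_energy, abs_zero]
  exact htol

variable {g₁ g₂}

/-- The OMF2 proposal is measurable (measurable forces). -/
theorem measurable_su2Omf2ProposalN [Countable ι] (hg₁ : Measurable g₁) (hg₂ : Measurable g₂) :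
    Measurable (⇑((flip : Equiv.Perm ((ι → Matrix.specialUnitaryGroup (Fin 2) ℂ) ×
      (ι → EuclideanSpace ℝ (Fin 3)))) * omf2Word g₁ (mulDrift (su2ExpDrift δ)) g₂ ^ n)) :=
  measurable_flip_omf2Word_pow (measurable_su2ExpDrift δ) hg₁ hg₂ n

variable [Fintype ι]

/-- **Liouville (OMF2, `SU(2)`)**: the proposal preserves `Haar^{⊗ι} ⊗ Lebesgue`, for every pair of
measurable forces. -/
theorem measurePreserving_su2Omf2ProposalN (hg₁ : Measurable g₁) (hg₂ : Measurable g₂) :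
    MeasurePreserving (⇑((flip : Equiv.Perm ((ι → Matrix.specialUnitaryGroup (Fin 2) ℂ) ×
      (ι → EuclideanSpace ℝ (Fin 3)))) * omf2Word g₁ (mulDrift (su2ExpDrift δ)) g₂ ^ n))
      ((Measure.pi fun _ : ι => haarProbability (Matrix.specialUnitaryGroup (Fin 2) ℂ)).prod
        (volume : Measure (ι → EuclideanSpace ℝ (Fin 3))))
      ((Measure.pi fun _ : ι => haarProbability (Matrix.specialUnitaryGroup (Fin 2) ℂ)).prod
        (volume : Measure (ι → EuclideanSpace ℝ (Fin 3)))) := by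
  haveI := isNegInvariant_volume_momenta (ι := ι)
  rw [Equiv.Perm.coe_mul]
  exact measurePreserving_flip.comp (measurePreserving_perm_pow
    (measurePreserving_palindromicWord (measurePreserving_kick hg₂)
      (omf2_stages_measurePreserving (measurable_mulDrift (measurable_su2ExpDrift δ))
        (measurePreserving_mulDrift (su2ExpDrift δ)) hg₁)) n)

/-- **THE FLUCTUATION RELATION OF `ΔH` FOR THE OMF2 PROPOSAL (`SU(2)`)**: for every Hamiltonian `H` on phase
space, every `g : ℝ → ℝ`, every pair of measurable forces, `δ`, `n`:
`∫ g(ΔH) e^{−H} = ∫ g(−ΔH) e^{−ΔH} e^{−H}` over `Haar^{⊗ι} ⊗ Lebesgue`. -/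
theorem su2Omf2ProposalN_fluctuation_relation (hg₁ : Measurable g₁) (hg₂ : Measurable g₂)
    (H : (ι → Matrix.specialUnitaryGroup (Fin 2) ℂ) × (ι → EuclideanSpace ℝ (Fin 3)) → ℝ) (g : ℝ → ℝ) :
    ∫ z, g (deltaH H (⇑((flip : Equiv.Perm ((ι → Matrix.specialUnitaryGroup (Fin 2) ℂ) ×
        (ι → EuclideanSpace ℝ (Fin 3)))) * omf2Word g₁ (mulDrift (su2ExpDrift δ)) g₂ ^ n)) z) * Real.exp (-H z)
      ∂((Measure.pi fun _ : ι => haarProbability (Matrix.specialUnitaryGroup (Fin 2) ℂ)).prod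
        (volume : Measure (ι → EuclideanSpace ℝ (Fin 3))))
    = ∫ z, g (-deltaH H (⇑((flip : Equiv.Perm ((ι → Matrix.specialUnitaryGroup (Fin 2) ℂ) ×
          (ι → EuclideanSpace ℝ (Fin 3)))) * omf2Word g₁ (mulDrift (su2ExpDrift δ)) g₂ ^ n)) z) *
        Real.exp (-deltaH H (⇑((flip : Equiv.Perm ((ι → Matrix.specialUnitaryGroup (Fin 2) ℂ) ×
          (ι → EuclideanSpace ℝ (Fin 3)))) * omf2Word g₁ (mulDrift (su2ExpDrift δ)) g₂ ^ n)) z) * Real.exp (-H z)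
      ∂((Measure.pi fun _ : ι => haarProbability (Matrix.specialUnitaryGroup (Fin 2) ℂ)).prod
        (volume : Measure (ι → EuclideanSpace ℝ (Fin 3)))) :=
  integral_comp_deltaH_eq (measurable_su2Omf2ProposalN δ n hg₁ hg₂) (involutive_su2Omf2ProposalN g₁ g₂ δ n)
    (measurePreserving_su2Omf2ProposalN δ n hg₁ hg₂) g

/-- **CREUTZ'S IDENTITY FOR THE OMF2 PROPOSAL (`SU(2)`)**: for every Hamiltonian `H` on phase space and every
pair of measurable forces, `∫ e^{−ΔH} e^{−H} = ∫ e^{−H}` over `Haar^{⊗ι} ⊗ Lebesgue`. -/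
theorem su2Omf2ProposalN_creutz (hg₁ : Measurable g₁) (hg₂ : Measurable g₂)
    (H : (ι → Matrix.specialUnitaryGroup (Fin 2) ℂ) × (ι → EuclideanSpace ℝ (Fin 3)) → ℝ) :
    ∫ z, Real.exp (-deltaH H (⇑((flip : Equiv.Perm ((ι → Matrix.specialUnitaryGroup (Fin 2) ℂ) ×
        (ι → EuclideanSpace ℝ (Fin 3)))) * omf2Word g₁ (mulDrift (su2ExpDrift δ)) g₂ ^ n)) z) * Real.exp (-H z)
      ∂((Measure.pi fun _ : ι => haarProbability (Matrix.specialUnitaryGroup (Fin 2) ℂ)).prod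
        (volume : Measure (ι → EuclideanSpace ℝ (Fin 3))))
    = ∫ z, Real.exp (-H z)
      ∂((Measure.pi fun _ : ι => haarProbability (Matrix.specialUnitaryGroup (Fin 2) ℂ)).prod
        (volume : Measure (ι → EuclideanSpace ℝ (Fin 3)))) :=
  creutz_integral (measurable_su2Omf2ProposalN δ n hg₁ hg₂) (involutive_su2Omf2ProposalN g₁ g₂ δ n)
    (measurePreserving_su2Omf2ProposalN δ n hg₁ hg₂)

end SU2

/-! ## §2 The `U(1)` rung -/

section U1

variable {ι : Type*} (g₁ g₂ : (ι → Circle) → ι → ℝ) (δ : ℝ) (n : ℕ)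

/-- **Time reversal (OMF2, `U(1)`)**: `flip ∘ (omf2Word g₁ (mulDrift (u1ExpDrift δ)) g₂)ⁿ` is an involution. -/
theorem involutive_u1Omf2ProposalN :
    Function.Involutive (⇑((flip : Equiv.Perm ((ι → Circle) × (ι → ℝ))) *
      omf2Word g₁ (mulDrift (u1ExpDrift δ)) g₂ ^ n)) :=
  (palindromicWord_pow_isFlipReversible flip_mul_flip (kick_isFlipReversible g₂)
    (omf2_stages_isFlipReversible (mulDrift_reversal (u1ExpDrift_neg δ))) n).involutive

/-- **THE REVERSIBILITY TEST (OMF2, `U(1)`)**: forward, flip, backward, flip is the identity. -/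
theorem u1Omf2_forward_flip_backward (z : (ι → Circle) × (ι → ℝ)) :
    ((flip : Equiv.Perm ((ι → Circle) × (ι → ℝ))) * omf2Word g₁ (mulDrift (u1ExpDrift δ)) g₂ ^ n)
      (((flip : Equiv.Perm ((ι → Circle) × (ι → ℝ))) * omf2Word g₁ (mulDrift (u1ExpDrift δ)) g₂ ^ n) z) = z :=
  involutive_u1Omf2ProposalN g₁ g₂ δ n z

/-- The round-trip change of ANY phase-space function is exactly `0` (`U(1)`). -/
theorem u1Omf2ProposalN_roundTrip_energy (Hf : (ι → Circle) × (ι → ℝ) → ℝ) (z : (ι → Circle) × (ι → ℝ)) :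
    Hf (((flip : Equiv.Perm ((ι → Circle) × (ι → ℝ))) * omf2Word g₁ (mulDrift (u1ExpDrift δ)) g₂ ^ n)
        (((flip : Equiv.Perm ((ι → Circle) × (ι → ℝ))) * omf2Word g₁ (mulDrift (u1ExpDrift δ)) g₂ ^ n) z))
      - Hf z = 0 := by
  rw [u1Omf2_forward_flip_backward, sub_self]

/-- … hence it passes the reversibility test at every tolerance `tol ≥ 0` (`U(1)`, exact arithmetic). -/
theorem u1Omf2ProposalN_roundTrip_abs_le (Hf : (ι → Circle) × (ι → ℝ) → ℝ) {tol : ℝ} (htol : 0 ≤ tol)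
    (z : (ι → Circle) × (ι → ℝ)) :
    |Hf (((flip : Equiv.Perm ((ι → Circle) × (ι → ℝ))) * omf2Word g₁ (mulDrift (u1ExpDrift δ)) g₂ ^ n)
        (((flip : Equiv.Perm ((ι → Circle) × (ι → ℝ))) * omf2Word g₁ (mulDrift (u1ExpDrift δ)) g₂ ^ n) z))
      - Hf z| ≤ tol := by
  rw [u1Omf2ProposalN_roundTrip_energy, abs_zero]
  exact htol

variable {g₁ g₂}

/-- The OMF2 proposal is measurable (`U(1)`, measurable forces). -/
theorem measurable_u1Omf2ProposalN [Countable ι] (hg₁ : Measurable g₁) (hg₂ : Measurable g₂) :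
    Measurable (⇑((flip : Equiv.Perm ((ι → Circle) × (ι → ℝ))) * omf2Word g₁ (mulDrift (u1ExpDrift δ)) g₂ ^ n)) :=
  measurable_flip_omf2Word_pow (measurable_u1ExpDrift δ) hg₁ hg₂ n

variable [Fintype ι]

/-- **Liouville (OMF2, `U(1)`)**: the proposal preserves `Haar^{⊗ι} ⊗ Lebesgue`. -/
theorem measurePreserving_u1Omf2ProposalN (hg₁ : Measurable g₁) (hg₂ : Measurable g₂) :
    MeasurePreserving (⇑((flip : Equiv.Perm ((ι → Circle) × (ι → ℝ))) * omf2Word g₁ (mulDrift (u1ExpDrift δ)) g₂ ^ n))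
      ((Measure.pi fun _ : ι => haarProbability Circle).prod (volume : Measure (ι → ℝ)))
      ((Measure.pi fun _ : ι => haarProbability Circle).prod (volume : Measure (ι → ℝ))) := by
  haveI := isNegInvariant_volume_pi (Λ := ι)
  rw [Equiv.Perm.coe_mul]
  exact measurePreserving_flip.comp (measurePreserving_perm_pow
    (measurePreserving_palindromicWord (measurePreserving_kick hg₂)
      (omf2_stages_measurePreserving (measurable_mulDrift (measurable_u1ExpDrift δ))
        (measurePreserving_mulDrift (u1ExpDrift δ)) hg₁)) n)

/-- **THE FLUCTUATION RELATION OF `ΔH` FOR THE OMF2 PROPOSAL (`U(1)`)**: for every `H`, every `g : ℝ → ℝ`,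
`∫ g(ΔH) e^{−H} = ∫ g(−ΔH) e^{−ΔH} e^{−H}` over `Haar^{⊗ι} ⊗ Lebesgue`. -/
theorem u1Omf2ProposalN_fluctuation_relation (hg₁ : Measurable g₁) (hg₂ : Measurable g₂)
    (H : (ι → Circle) × (ι → ℝ) → ℝ) (g : ℝ → ℝ) :
    ∫ z, g (deltaH H (⇑((flip : Equiv.Perm ((ι → Circle) × (ι → ℝ))) *
        omf2Word g₁ (mulDrift (u1ExpDrift δ)) g₂ ^ n)) z) * Real.exp (-H z)
      ∂((Measure.pi fun _ : ι => haarProbability Circle).prod (volume : Measure (ι → ℝ)))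
    = ∫ z, g (-deltaH H (⇑((flip : Equiv.Perm ((ι → Circle) × (ι → ℝ))) *
          omf2Word g₁ (mulDrift (u1ExpDrift δ)) g₂ ^ n)) z) *
        Real.exp (-deltaH H (⇑((flip : Equiv.Perm ((ι → Circle) × (ι → ℝ))) *
          omf2Word g₁ (mulDrift (u1ExpDrift δ)) g₂ ^ n)) z) * Real.exp (-H z)
      ∂((Measure.pi fun _ : ι => haarProbability Circle).prod (volume : Measure (ι → ℝ))) :=
  integral_comp_deltaH_eq (measurable_u1Omf2ProposalN δ n hg₁ hg₂) (involutive_u1Omf2ProposalN g₁ g₂ δ n)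
    (measurePreserving_u1Omf2ProposalN δ n hg₁ hg₂) g

/-- **CREUTZ'S IDENTITY FOR THE OMF2 PROPOSAL (`U(1)`)**: for every `H` and every pair of measurable forces,
`∫ e^{−ΔH} e^{−H} = ∫ e^{−H}` over `Haar^{⊗ι} ⊗ Lebesgue`. -/
theorem u1Omf2ProposalN_creutz (hg₁ : Measurable g₁) (hg₂ : Measurable g₂) (H : (ι → Circle) × (ι → ℝ) → ℝ) :
    ∫ z, Real.exp (-deltaH H (⇑((flip : Equiv.Perm ((ι → Circle) × (ι → ℝ))) *
        omf2Word g₁ (mulDrift (u1ExpDrift δ)) g₂ ^ n)) z) * Real.exp (-H z)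
      ∂((Measure.pi fun _ : ι => haarProbability Circle).prod (volume : Measure (ι → ℝ)))
    = ∫ z, Real.exp (-H z) ∂((Measure.pi fun _ : ι => haarProbability Circle).prod (volume : Measure (ι → ℝ))) :=
  creutz_integral (measurable_u1Omf2ProposalN δ n hg₁ hg₂) (involutive_u1Omf2ProposalN g₁ g₂ δ n)
    (measurePreserving_u1Omf2ProposalN δ n hg₁ hg₂)

end U1

end Summit.Ventures.LatticeQCDFlow.Exactness
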